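import Summits.AtomisticToContinuum.Crystallization.Theorems.PricedLinkCensusTruncatedCensusGapRingCensusGapOfPeriodicRingPricing
import Summits.AtomisticToContinuum.Crystallization.Theorems.PricedLinkCensusTruncatedCensusGapPeriodicRingPricingOfRingCensusGap

/-!
# `stub_ringCensusGap` (class (R) of line `birth`) is EQUIVALENT to the periodic (R)-pricing

Crux `PricedLinkCensus.TruncatedCensusGap` (item stmt-AtomisticToContinuum-14230), census split
`Cruxes/TruncatedCensusGap/Lines/birth.lean`, stub `stub_ringCensusGap`.  Composition of the two
landed directions `ringCensusGap_of_periodicRingPricing` (far periodisation) and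
`periodicRingPricing_of_ringCensusGap` (blocks): the registered statement of `stub_ringCensusGap`
holds iff some `κ > 0` prices, in EVERY periodic configuration `Q` of `ℝ³`, each ring-defective
motif site (twelve bonds and a bond of ring number `≠ 4` in the scale-free bond graph of
`Q.points` at tolerance `1/100`) at `κ` above the periodic infimum `e_χ*` of the range-2
potential `V_χ`: `κ · #R(Q) ≤ #F · (e_χ(Q) − e_χ*)` — the `R`-twin of
`truncatedCensusGap_iff_periodicPricing`.  So the open content of the stub is exactly finite-range
PERIODIC crystallization with tetrahedral-frustration pricing for `V_χ` (no named fact of the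
tree).  `[folklore]` bookkeeping.
-/

noncomputable section

namespace Summit.AtomisticToContinuum.Crystallization.Theorems.PricedLinkCensusTruncatedCensusGap

open Literature.MathematicalPhysics.StatisticalMechanics Literature.Geometry.DiscreteGeometry

/-- **`stub_ringCensusGap` ↔ periodic (R)-pricing for `V_χ`.** [folklore] -/
theorem ringCensusGap_iff_periodicRingPricing : (∃ κ : ℝ, 0 < κ ∧ ∀ (N : ℕ) (y : Fin N → EuclideanSpace ℝ (Fin 3)), Function.Injective y → (N : ℝ) * (⨅ Q : Literature.MathematicalPhysics.StatisticalMechanics.PeriodicConfiguration 3, Q.energyPerParticle (fun r => min 1 (max 0 (4 - 2 * r)) * Literature.MathematicalPhysics.StatisticalMechanics.lennardJones r)) + κ * (Nat.card {i : Fin N // ((Literature.Geometry.DiscreteGeometry.bondGraph (1 / 100 : ℝ) y).neighborSet i).ncard = 12 ∧ ∃ j ∈ (Literature.Geometry.DiscreteGeometry.bondGraph (1 / 100 : ℝ) y).neighborSet i, Literature.Geometry.DiscreteGeometry.ringNumber (1 / 100 : ℝ) y i j ≠ 4} : ℝ) ≤ Literature.MathematicalPhysics.StatisticalMechanics.interactionEnergy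 (fun r => min 1 (max 0 (4 - 2 * r)) * Literature.MathematicalPhysics.StatisticalMechanics.lennardJones r) y) ↔ ∃ κ : ℝ, 0 < κ ∧ ∀ Q : Literature.MathematicalPhysics.StatisticalMechanics.PeriodicConfiguration 3, κ * (Nat.card {x : Q.motif // ((Literature.Geometry.DiscreteGeometry.bondGraph (1 / 100 : ℝ) (Subtype.val : Q.points → EuclideanSpace ℝ (Fin 3))).neighborSet ⟨x.1, Q.mem_points_of_mem_motif x.2⟩).ncard = 12 ∧ ∃ q ∈ (Literature.Geometry.DiscreteGeometry.bondGraph (1 / 100 : ℝ) (Subtype.val : Q.points → EuclideanSpace ℝ (Fin 3))).neighborSet ⟨x.1, Q.mem_points_of_mem_motif x.2⟩, Literature.Geometry.DiscreteGeometry.ringNumber (1 / 100 : ℝ) (Subtype.val : Q.points → EuclideanSpace ℝ (Fin 3)) ⟨x.1, Q.mem_points_of_mem_motif x.2⟩ q ≠ 4} : ℝ) ≤ (Q.motif.card : ℝ) * (Q.energyPerParticle (fun r => min 1 (max 0 (4 - 2 * r)) * Literature.MathematicalPhysics.StatisticalMechanics.lennardJones r) - ⨅ Q' : Literature.MathematicalPhysics.StatisticalMechanics.PeriodicConfiguration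 3, Q'.energyPerParticle (fun r => min 1 (max 0 (4 - 2 * r)) * Literature.MathematicalPhysics.StatisticalMechanics.lennardJones r)) :=
  ⟨periodicRingPricing_of_ringCensusGap, ringCensusGap_of_periodicRingPricing⟩

end Summit.AtomisticToContinuum.Crystallization.Theorems.PricedLinkCensusTruncatedCensusGap

end
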